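import Mathlib
import Summits.Ventures.PercRepro2.Defs
import Summits.Ventures.PercRepro2.Independence
import Summits.Ventures.PercRepro2.Harris

/-!
# Four functions (Ahlswede–Daykin) bridge for finite bond percolation (blind cell PercRepro2, p1)

`Config E = E → Bool` is a finite distributive lattice (pointwise `||` / `&&`), and the product
Bernoulli weight is *log-modular* on it:
`weight p (ω ⊓ ω') * weight p (ω ⊔ ω') = weight p ω * weight p ω'`.
Hence Mathlib's `four_functions_theorem_univ` (Ahlswede–Daykin) gives, for events `A B C D`,
`prob p A * prob p B ≤ prob p C * prob p D` as soon as
`ω ∈ A → ω' ∈ B → ω ⊔ ω' ∈ C ∧ ω ⊓ ω' ∈ D`  (`prob_mul_prob_le_of_sup_inf`).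
Harris–FKG (`prob_mul_prob_le_prob_inter`, proved by pinning induction in `Harris.lean`) is the
special case `C = A ∩ B`, `D = univ`; the general form also covers inequalities between
NON-monotone events (e.g. partition events of marked vertices), which is why it is recorded here.
-/

namespace Summit.Ventures.PercRepro2

section LogModular

variable {E : Type*} [Fintype E] {R : Type*} [CommRing R]

/-- On `Bool`, the Bernoulli factor is log-modular (all four cases). -/
lemma edgeFactor_inf_mul_sup (q : R) (a b : Bool) :
    edgeFactor q (a ⊓ b) * edgeFactor q (a ⊔ b) = edgeFactor q a * edgeFactor q b := by
  cases a <;> cases b <;> simp [edgeFactor, mul_comm]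

/-- **Log-modularity** of the product Bernoulli weight on the lattice `Config E`. -/
lemma weight_inf_mul_weight_sup (p : E → R) (ω ω' : Config E) :
    weight p (ω ⊓ ω') * weight p (ω ⊔ ω') = weight p ω * weight p ω' := by
  unfold weight
  rw [← Finset.prod_mul_distrib, ← Finset.prod_mul_distrib]
  exact Finset.prod_congr rfl fun e _ => edgeFactor_inf_mul_sup (p e) (ω e) (ω' e)

end LogModular

section FourFunctions

variable {E : Type*} [Fintype E] [DecidableEq E]
  {R : Type*} [CommRing R] [LinearOrder R] [IsStrictOrderedRing R]

omit [DecidableEq E] in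
/-- Indicator-weighted functions are nonnegative for admissible weights. -/
lemma indicator_weight_nonneg {p : E → R} (hp : IsProbVec p) (A : Set (Config E)) :
    0 ≤ A.indicator (weight p) :=
  fun ω => Set.indicator_nonneg (fun ω _ => weight_nonneg hp ω) ω

/-- **Four functions theorem for events** (Ahlswede–Daykin): if `ω ∈ A` and `ω' ∈ B` force
`ω ⊔ ω' ∈ C` and `ω ⊓ ω' ∈ D`, then `P(A) P(B) ≤ P(C) P(D)`. -/
theorem prob_mul_prob_le_of_sup_inf {p : E → R} (hp : IsProbVec p) {A B C D : Set (Config E)}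
    (h : ∀ ω ∈ A, ∀ ω' ∈ B, ω ⊔ ω' ∈ C ∧ ω ⊓ ω' ∈ D) :
    prob p A * prob p B ≤ prob p C * prob p D := by
  classical
  unfold prob
  have key := four_functions_theorem_univ (A.indicator (weight p)) (B.indicator (weight p))
    (D.indicator (weight p)) (C.indicator (weight p))
    (indicator_weight_nonneg hp A) (indicator_weight_nonneg hp B)
    (indicator_weight_nonneg hp D) (indicator_weight_nonneg hp C) (fun ω ω' => ?_)
  · rw [mul_comm (∑ ω, D.indicator (weight p) ω)] at key
    exact key
  · by_cases hA : ω ∈ A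
    · by_cases hB : ω' ∈ B
      · obtain ⟨hC, hD⟩ := h ω hA ω' hB
        rw [Set.indicator_of_mem hA, Set.indicator_of_mem hB, Set.indicator_of_mem hD,
          Set.indicator_of_mem hC, weight_inf_mul_weight_sup]
      · rw [Set.indicator_of_notMem hB, mul_zero]
        exact mul_nonneg (indicator_weight_nonneg hp D _) (indicator_weight_nonneg hp C _)
    · rw [Set.indicator_of_notMem hA, zero_mul]
      exact mul_nonneg (indicator_weight_nonneg hp D _) (indicator_weight_nonneg hp C _)

/-- Harris–FKG for increasing events, re-derived from the four functions theorem
(`C = A ∩ B`, `D = univ`); the pinning-induction proof is `prob_mul_prob_le_prob_inter`. -/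
theorem prob_mul_prob_le_prob_inter' {p : E → R} (hp : IsProbVec p) {A B : Set (Config E)}
    (hA : IsUpperSet A) (hB : IsUpperSet B) : prob p A * prob p B ≤ prob p (A ∩ B) := by
  have := prob_mul_prob_le_of_sup_inf hp (A := A) (B := B) (C := A ∩ B) (D := Set.univ)
    (fun ω hω ω' hω' => ⟨⟨hA le_sup_left hω, hB le_sup_right hω'⟩, Set.mem_univ _⟩)
  simpa using this

end FourFunctions

end Summit.Ventures.PercRepro2
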